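import Literature.Barriers.CriticalPhenomena.TimarSlabs
import HarnessLib

/-!
# Timár 2006, proof of Thm. 5.5 (first step): the bad heavy clusters — invariance,
# measurability, and "almost surely none or infinitely many" by insertion tolerance — PROVED

Barrier catalogue `Literature/Barriers/CriticalPhenomena/`; a brick of the programme proving
Timár's Thm. 5.5 (`Timar2006_finiteLevelUnion`, `TimarCriticalNonunimodular.lean`). Á. Timár,
*Percolation on nonunimodular transitive graphs*, Ann. Probab. 34 (2006) 2344–2364, §5, proof of
Thm. 5.5 (p. 2358 of the journal, p. 15 of arXiv:math/0702875):

> "Suppose that for some heavy cluster `C` and any `L` that is a finite union of levels, all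
> connected components in `C ∩ L` are finite. Let `ω̄` be the subgraph consisting of these `C`'s.
> Note that `ω̄` is invariant. … By Lemma 5.3, there are encounter points in `ω̄`, hence any
> `L₀` contains an encounter point with positive probability"

and Lemma 5.3 ("Suppose that there are infinitely many heavy clusters in `ω`. Then every heavy
cluster in `ω` contains infinitely many encounter points. … *Proof.* The existence of encounter
points follows from insertion tolerance."). Call a cluster `C` with the displayed property **bad**
(`LevelBad`: every vertex `y` of `C` has, for every finite set `S` of level representatives, a
finite open cluster constrained to the union `levelUnion G S` of the levels of `S` — literally
the negation of the conclusion of the vendored `Timar2006_finiteLevelUnion` for the cluster `C`).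
The forest of the printed proof is built on encounter points lying in BAD heavy clusters, and the
local modification producing such a point ("follows from insertion tolerance") glues together
three bad heavy clusters near a vertex; that at least three (indeed infinitely many) bad heavy
clusters are available as soon as one is, is the Newman–Schulman-type statement proved here:

* `LevelBad`, `badHeavyClusters` (the set `ω̄` of the printed proof, as a set of open clusters),
  `badHeavyClusters_eq_empty_iff` (no bad heavy cluster ↔ the conclusion of Thm. 5.5 for `ω`),
  `le_encard_badHeavyClusters_iff` ("at least `k` bad heavy clusters" through `k` pairwise
  disconnected vertices);
* invariance under `Aut(G)` ("Note that `ω̄` is invariant": `levelBad_relabel_iff`,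
  `le_encard_badHeavyClusters_relabel_iff`) and measurability (`measurableSet_levelBad`,
  `measurableSet_le_encard_badHeavyClusters`, …);
* **merging lowers the number of bad heavy clusters** (`union_not_le_encard_badHeavyClusters`):
  if `ω` has exactly `k < ∞` bad heavy clusters, `C(x)` is bad and heavy, `C(y) ≠ C(x)` is heavy,
  and `F` is the edge set of a walk from `x` to `y`, then `ω ∪ F` has fewer than `k` bad heavy
  clusters (a bad heavy cluster of `ω ∪ F` contains a bad heavy cluster of `ω`,
  `exists_isHeavy_levelBad_of_union_finset`; the merged cluster is bad only if `C(y)` was);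
* **`ae_badHeavyClusters_empty_or_infinite`** — on a connected, locally finite, quasi-transitive
  infinite graph, under `P_p` with almost surely infinitely many heavy clusters, almost surely
  there are no bad heavy clusters or infinitely many (each `{#bad = k}` is invariant, hence
  trivial by ergodicity, `bondPercolation_zero_one_of_autInvariant`; `1 ≤ k < ∞` is excluded by
  insertion tolerance, `bondPercolation_real_pos_of_openEdges`, and the merging lemma);
  `ae_infinite_badHeavyClusters_of_not_ae_empty` — if bad heavy clusters are not almost surely
  absent, there are almost surely infinitely many;
* `Timar2006_finiteLevelUnion_of_not_ae_infinite_bad` — **reduction of Thm. 5.5**: it suffices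
  to refute "almost surely infinitely many bad heavy clusters" on an infinite countable graph with
  `0 < p < 1` (under the other hypotheses of the vendored fact; `pos_of_ae_infinite_heavyClusters`,
  `lt_one_of_ae_infinite_heavyClusters`), which is what the rest of the printed proof does.

## References

* Á. Timár, Ann. Probab. 34 (2006) 2344–2364 (arXiv:math/0702875), §5: Lemma 5.3 and its proof
  ("follows from insertion tolerance"), proof of Thm. 5.5 (the invariant subgraph `ω̄`). [Timar2006]
* R. Lyons, Y. Peres, *Probability on Trees and Networks*, CUP 2016, Prop. 7.3 and Thm. 7.5
  (proof: ergodicity and "N takes a strictly smaller value" under insertion). [LyonsPeres2016]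
-/

noncomputable section

namespace Literature.Barriers.CriticalPhenomena

open _root_.MeasureTheory _root_.Filter Literature.Probability.LatticeModels
  Literature.Probability.Percolation SimpleGraph
open scoped ENNReal

variable {V : Type*}

/-! ### Bad clusters -/

/-- **The cluster of `x` is bad**: for every finite set `S` of level representatives and every
vertex `y` of `C(x)`, the open cluster of `y` constrained to the union of the levels of `S` is
finite ("for some heavy cluster `C` and any `L` that is a finite union of levels, all connected
components in `C ∩ L` are finite", proof of Thm. 5.5) — the negation, for the cluster `C(x)`, of
the conclusion of `Timar2006_finiteLevelUnion`. [cite: Timar2006, Thm. 5.5 (proof, first sentence)] -/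
def LevelBad (G : SimpleGraph V) (ω : BondConfig V) (x : V) : Prop :=
  ∀ S : Finset V, ∀ y ∈ openCluster ω x,
    (openClusterIn (withinGraph G (levelUnion G S)) ω y).Finite

/-- Badness is a property of the cluster: it passes to every vertex of `C(x)`. [folklore] -/
theorem LevelBad.of_mem {G : SimpleGraph V} {ω : BondConfig V} {x x' : V} (h : LevelBad G ω x)
    (hx' : x' ∈ openCluster ω x) : LevelBad G ω x' := by
  intro S y hy
  exact h S y ((show (openGraph ω).Reachable x x' from hx').trans hy)

/-- Badness of `C(x)` and of `C(x')` agree for `x' ∈ C(x)`. [folklore] -/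
theorem levelBad_iff_of_mem {G : SimpleGraph V} {ω : BondConfig V} {x x' : V}
    (hx' : x' ∈ openCluster ω x) : LevelBad G ω x' ↔ LevelBad G ω x :=
  ⟨fun h => h.of_mem (show (openGraph ω).Reachable x' x from
    (show (openGraph ω).Reachable x x' from hx').symm), fun h => h.of_mem hx'⟩

/-- `C(x)` is not bad iff some vertex of `C(x)` has an infinite cluster constrained to some finite
union of levels — the conclusion of Thm. 5.5 for `C(x)`. [cite: Timar2006, Thm. 5.5] -/
theorem not_levelBad_iff {G : SimpleGraph V} {ω : BondConfig V} {x : V} :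
    ¬ LevelBad G ω x ↔ ∃ S : Finset V, ∃ y ∈ openCluster ω x,
      (openClusterIn (withinGraph G (levelUnion G S)) ω y).Infinite := by
  simp only [LevelBad, not_forall, exists_prop, ← Set.not_infinite, not_not]

/-- **Inserting edges cannot make a good cluster bad**: if `ω ⊆ ω'` and the `ω'`-cluster of `z`
is bad, then the `ω`-cluster of every `u ∈ C_{ω'}(z)` is bad (clusters and constrained clusters
only grow with the configuration). [cite: Timar2006, Lemma 5.3 (proof: insertion tolerance)] -/
theorem LevelBad.anti_of_mem {G : SimpleGraph V} {ω ω' : BondConfig V} (hω : ω ⊆ ω') {z u : V}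
    (h : LevelBad G ω' z) (hu : u ∈ openCluster ω' z) : LevelBad G ω u := by
  intro S y hy
  have hy' : y ∈ openCluster ω' z :=
    (show (openGraph ω').Reachable z u from hu).trans (openCluster_mono hω u hy)
  exact (h S y hy').subset (openClusterIn_mono_config _ hω y)

/-- In particular badness is antitone in the configuration. [folklore] -/
theorem LevelBad.anti {G : SimpleGraph V} {ω ω' : BondConfig V} (hω : ω ⊆ ω') {z : V}
    (h : LevelBad G ω' z) : LevelBad G ω z :=
  h.anti_of_mem hω (mem_openCluster_self ω' z)

/-- The set of **bad heavy clusters** of `ω` (the clusters making up the invariant subgraph `ω̄`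
of the proof of Thm. 5.5): connected components of the open graph whose vertex set is heavy
(weights based at `o`) and bad. [cite: Timar2006, Thm. 5.5 (proof: "Let ω̄ be the subgraph consisting of these C's")] -/
def badHeavyClusters (G : SimpleGraph V) (o : V) (ω : BondConfig V) :
    Set (openGraph ω).ConnectedComponent :=
  {C | IsHeavy G o C.supp ∧ ∀ x ∈ C.supp, LevelBad G ω x}

/-- The component of `x` is a bad heavy cluster iff `C(x)` is heavy and bad. [folklore] -/
theorem connectedComponentMk_mem_badHeavyClusters_iff (G : SimpleGraph V) (o : V)
    (ω : BondConfig V) (x : V) :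
    (openGraph ω).connectedComponentMk x ∈ badHeavyClusters G o ω ↔
      IsHeavy G o (openCluster ω x) ∧ LevelBad G ω x := by
  rw [badHeavyClusters, Set.mem_setOf_eq, ← openCluster_eq_supp]
  exact and_congr Iff.rfl
    ⟨fun h => h x (mem_openCluster_self ω x), fun h x' hx' => h.of_mem hx'⟩

/-- Bad heavy clusters are heavy clusters. [folklore] -/
theorem badHeavyClusters_subset_heavyClusters (G : SimpleGraph V) (o : V) (ω : BondConfig V) :
    badHeavyClusters G o ω ⊆ heavyClusters G o ω :=
  fun _ hC => hC.1

/-- **No bad heavy cluster ↔ the conclusion of Thm. 5.5 for `ω`**: every heavy `C(x)` has a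
vertex with an infinite cluster constrained to some finite union of levels.
[cite: Timar2006, Thm. 5.5 (statement and first sentence of the proof)] -/
theorem badHeavyClusters_eq_empty_iff (G : SimpleGraph V) (o : V) (ω : BondConfig V) :
    badHeavyClusters G o ω = ∅ ↔ ∀ x : V, IsHeavy G o (openCluster ω x) →
      ∃ S : Finset V, ∃ y ∈ openCluster ω x,
        (openClusterIn (withinGraph G (levelUnion G S)) ω y).Infinite := by
  constructor
  · intro h x hx
    by_contra hno
    have hbad : LevelBad G ω x := by
      rw [← not_not (a := LevelBad G ω x), not_levelBad_iff]
      exact hno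
    have hmem := (connectedComponentMk_mem_badHeavyClusters_iff G o ω x).2 ⟨hx, hbad⟩
    rw [h] at hmem
    exact hmem
  · intro h
    refine Set.eq_empty_of_forall_notMem fun C hC => ?_
    induction C using ConnectedComponent.ind with
    | h x =>
      rw [connectedComponentMk_mem_badHeavyClusters_iff] at hC
      obtain ⟨S, y, hy, hinf⟩ := h x hC.1
      exact hinf (hC.2 S y hy)

/-! ### Counting bad heavy clusters through vertices -/

/-- **"At least `k` bad heavy clusters" in terms of vertices**: `k ≤ |bad heavy clusters|` iff
there are `k` vertices with bad heavy open clusters, no two joined by an open path (as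
`le_encard_heavyClusters_iff`). [folklore] -/
theorem le_encard_badHeavyClusters_iff (G : SimpleGraph V) (o : V) (ω : BondConfig V) (k : ℕ) :
    (k : ℕ∞) ≤ (badHeavyClusters G o ω).encard ↔
      ∃ s : Finset V, s.card = k ∧
        (∀ x ∈ s, IsHeavy G o (openCluster ω x) ∧ LevelBad G ω x) ∧
        (↑s : Set V).Pairwise fun x y => ¬ (openGraph ω).Reachable x y := by
  classical
  constructor
  · intro hk
    obtain ⟨t, htS, ht⟩ := Set.exists_subset_encard_eq hk
    have htfin : t.Finite := Set.finite_of_encard_eq_coe ht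
    have hrep : ∀ C : (openGraph ω).ConnectedComponent, ∃ v,
        (openGraph ω).connectedComponentMk v = C := fun C => C.ind fun v => ⟨v, rfl⟩
    choose rep hrep using hrep
    have hrinj : Function.Injective rep := fun C D h => by rw [← hrep C, ← hrep D, h]
    refine ⟨htfin.toFinset.image rep, ?_, ?_, ?_⟩
    · rw [Finset.card_image_of_injective _ hrinj]
      have := htfin.encard_eq_coe_toFinset_card
      rw [ht] at this
      exact_mod_cast this.symm
    · intro x hx
      rw [Finset.mem_image] at hx
      obtain ⟨C, hC, rfl⟩ := hx
      rw [← connectedComponentMk_mem_badHeavyClusters_iff, hrep]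
      exact htS (htfin.mem_toFinset.1 hC)
    · intro x hx y hy hxy hr
      rw [Finset.coe_image, Set.mem_image] at hx hy
      obtain ⟨C, -, rfl⟩ := hx
      obtain ⟨D, -, rfl⟩ := hy
      apply hxy
      have hCD : C = D := by
        rw [← hrep C, ← hrep D]
        exact ConnectedComponent.sound hr
      rw [hCD]
  · rintro ⟨s, hcard, hbad, hpair⟩
    have hinj : Set.InjOn (fun x => (openGraph ω).connectedComponentMk x) ↑s := by
      intro x hx y hy hxy
      by_contra hne
      exact hpair hx hy hne (ConnectedComponent.exact hxy)
    have hsub : (fun x => (openGraph ω).connectedComponentMk x) '' ↑s ⊆ badHeavyClusters G o ω := by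
      rintro _ ⟨x, hx, rfl⟩
      exact (connectedComponentMk_mem_badHeavyClusters_iff G o ω x).2 (hbad x hx)
    calc (k : ℕ∞) = (↑s : Set V).encard := by rw [Set.encard_coe_eq_coe_finsetCard, hcard]
      _ = ((fun x => (openGraph ω).connectedComponentMk x) '' ↑s).encard := (hinj.encard_image).symm
      _ ≤ (badHeavyClusters G o ω).encard := Set.encard_le_encard hsub

/-- There are infinitely many bad heavy clusters iff there are at least `k` for every `k`.
[folklore] -/
theorem infinite_badHeavyClusters_iff (G : SimpleGraph V) (o : V) (ω : BondConfig V) :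
    (badHeavyClusters G o ω).Infinite ↔ ∀ k : ℕ, (k : ℕ∞) ≤ (badHeavyClusters G o ω).encard := by
  rw [← Set.encard_eq_top_iff, ENat.eq_top_iff_forall_ge]

/-! ### Invariance under automorphisms ("Note that `ω̄` is invariant") -/

/-- Automorphisms permute the levels: `γ v` lies in the union of the levels of `γ(S)` iff `v`
lies in the union of the levels of `S`. [folklore] -/
theorem map_mem_levelUnion_image_iff [DecidableEq V] {G : SimpleGraph V} (γ : G ≃g G)
    (S : Finset V) (v : V) : γ v ∈ levelUnion G (S.image γ) ↔ v ∈ levelUnion G S := by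
  simp only [mem_levelUnion_iff, Finset.mem_image]
  constructor
  · rintro ⟨_, ⟨s, hs, rfl⟩, h⟩
    exact ⟨s, hs, (sameLevel_map_iff γ s v).1 h⟩
  · rintro ⟨s, hs, h⟩
    exact ⟨γ s, ⟨s, hs, rfl⟩, (sameLevel_map_iff γ s v).2 h⟩

/-- The step graphs of the level unions of `S` and of `γ(S)` correspond under `γ`. [folklore] -/
theorem withinGraph_levelUnion_image_adj_iff [DecidableEq V] {G : SimpleGraph V} (γ : G ≃g G)
    (S : Finset V) (u v : V) :
    (withinGraph G (levelUnion G (S.image γ))).Adj (γ u) (γ v) ↔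
      (withinGraph G (levelUnion G S)).Adj u v := by
  rw [withinGraph_adj, withinGraph_adj, map_mem_levelUnion_image_iff, map_mem_levelUnion_image_iff,
    γ.map_rel_iff]

/-- Constrained clusters are transported: the cluster of `γ y` constrained to the levels of
`γ(S)` in `γ ω` is the image of the cluster of `y` constrained to the levels of `S` in `ω`.
[folklore] -/
theorem openClusterIn_levelUnion_relabel [DecidableEq V] {G : SimpleGraph V} (γ : G ≃g G)
    (S : Finset V) (ω : BondConfig V) (y : V) :
    openClusterIn (withinGraph G (levelUnion G (S.image γ)))
        (BondConfig.relabel (sym2Equiv γ.toEquiv) ω) (γ y) =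
      (γ : V → V) '' openClusterIn (withinGraph G (levelUnion G S)) ω y :=
  openClusterIn_relabel γ.toEquiv (fun u v => withinGraph_levelUnion_image_adj_iff γ S u v) ω y

/-- `γ(γ⁻¹(S)) = S` for finite sets of vertices. [folklore] -/
theorem finset_image_symm_image_iso [DecidableEq V] {G : SimpleGraph V} (γ : G ≃g G) (S : Finset V) :
    (S.image γ.symm).image γ = S := by
  ext z
  simp only [Finset.mem_image]
  constructor
  · rintro ⟨_, ⟨s, hs, rfl⟩, rfl⟩
    rwa [RelIso.apply_symm_apply]
  · intro hz
    exact ⟨γ.symm z, ⟨z, hz, rfl⟩, RelIso.apply_symm_apply γ z⟩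

/-- **Badness is invariant under automorphisms**: `C_{γω}(γ x)` is bad iff `C_ω(x)` is.
[cite: Timar2006, Thm. 5.5 (proof: "Note that ω̄ is invariant")] -/
theorem levelBad_relabel_iff {G : SimpleGraph V} (γ : G ≃g G) (ω : BondConfig V) (x : V) :
    LevelBad G (BondConfig.relabel (sym2Equiv γ.toEquiv) ω) (γ x) ↔ LevelBad G ω x := by
  classical
  have hC : openCluster (BondConfig.relabel (sym2Equiv γ.toEquiv) ω) (γ x) =
      (γ : V → V) '' openCluster ω x := (image_openCluster_relabel γ.toEquiv ω x).symm
  constructor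
  · intro h S y hy
    have hy' : γ y ∈ openCluster (BondConfig.relabel (sym2Equiv γ.toEquiv) ω) (γ x) := by
      rw [hC]; exact ⟨y, hy, rfl⟩
    have hfin := h (S.image γ) (γ y) hy'
    rw [openClusterIn_levelUnion_relabel γ S ω y] at hfin
    exact (Set.finite_image_iff γ.injective.injOn).1 hfin
  · intro h S y' hy'
    rw [hC] at hy'
    obtain ⟨y, hy, rfl⟩ := hy'
    have hfin := h (S.image γ.symm) y hy
    have key := openClusterIn_levelUnion_relabel γ (S.image γ.symm) ω y
    rw [finset_image_symm_image_iso] at key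
    rw [key]
    exact hfin.image _

/-- "At least `k` bad heavy clusters" is invariant under relabelling by an automorphism
(connected, locally finite `G`: heaviness is invariant, `isHeavy_image_iff`).
[cite: Timar2006, Thm. 5.5 (proof: "Note that ω̄ is invariant")] -/
theorem le_encard_badHeavyClusters_relabel_iff (G : SimpleGraph V) [G.LocallyFinite]
    (hconn : G.Connected) (γ : G ≃g G) (o : V) (ω : BondConfig V) (k : ℕ) :
    (k : ℕ∞) ≤ (badHeavyClusters G o (BondConfig.relabel (sym2Equiv γ.toEquiv) ω)).encard ↔
      (k : ℕ∞) ≤ (badHeavyClusters G o ω).encard := by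
  classical
  set φ : V ≃ V := γ.toEquiv with hφ
  -- the two vertex conditions are invariant
  have hvert : ∀ x', IsHeavy G o (openCluster (BondConfig.relabel (sym2Equiv φ) ω) (φ x')) ∧
      LevelBad G (BondConfig.relabel (sym2Equiv φ) ω) (φ x') ↔
        IsHeavy G o (openCluster ω x') ∧ LevelBad G ω x' := by
    intro x'
    rw [← image_openCluster_relabel]
    change IsHeavy G o ((γ : V → V) '' openCluster ω x') ∧
      LevelBad G (BondConfig.relabel (sym2Equiv γ.toEquiv) ω) (γ x') ↔ _
    rw [isHeavy_image_iff G hconn γ, levelBad_relabel_iff γ ω x']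
  rw [le_encard_badHeavyClusters_iff, le_encard_badHeavyClusters_iff]
  constructor
  · rintro ⟨s, hcard, hbad, hpair⟩
    refine ⟨s.image φ.symm, ?_, ?_, ?_⟩
    · rw [Finset.card_image_of_injective _ φ.symm.injective, hcard]
    · intro x hx
      rw [Finset.mem_image] at hx
      obtain ⟨x', hx', rfl⟩ := hx
      have h := hbad x' hx'
      rw [show x' = φ (φ.symm x') from (φ.apply_symm_apply x').symm] at h
      exact (hvert _).1 h
    · intro x hx y hy hxy
      rw [Finset.coe_image, Set.mem_image] at hx hy
      obtain ⟨x', hx', rfl⟩ := hx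
      obtain ⟨y', hy', rfl⟩ := hy
      rw [← reachable_relabel_iff φ, φ.apply_symm_apply, φ.apply_symm_apply]
      exact hpair hx' hy' fun h => hxy (by rw [h])
  · rintro ⟨s, hcard, hbad, hpair⟩
    refine ⟨s.image φ, ?_, ?_, ?_⟩
    · rw [Finset.card_image_of_injective _ φ.injective, hcard]
    · intro x hx
      rw [Finset.mem_image] at hx
      obtain ⟨x', hx', rfl⟩ := hx
      exact (hvert x').2 (hbad x' hx')
    · intro x hx y hy hxy
      rw [Finset.coe_image, Set.mem_image] at hx hy
      obtain ⟨x', hx', rfl⟩ := hx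
      obtain ⟨y', hy', rfl⟩ := hy
      rw [reachable_relabel_iff φ]
      exact hpair hx' hy' fun h => hxy (by rw [h])

/-- **"Infinitely many bad heavy clusters" is an invariant event.**
[cite: Timar2006, Thm. 5.5 (proof: "Note that ω̄ is invariant")] -/
theorem infinite_badHeavyClusters_relabel_iff (G : SimpleGraph V) [G.LocallyFinite]
    (hconn : G.Connected) (γ : G ≃g G) (o : V) (ω : BondConfig V) :
    (badHeavyClusters G o (BondConfig.relabel (sym2Equiv γ.toEquiv) ω)).Infinite ↔
      (badHeavyClusters G o ω).Infinite := by
  rw [infinite_badHeavyClusters_iff, infinite_badHeavyClusters_iff]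
  exact forall_congr' fun k => le_encard_badHeavyClusters_relabel_iff G hconn γ o ω k

/-- **The number of bad heavy clusters is invariant** under automorphisms.
[cite: Timar2006, Thm. 5.5 (proof: "Note that ω̄ is invariant")] -/
theorem encard_badHeavyClusters_relabel (G : SimpleGraph V) [G.LocallyFinite]
    (hconn : G.Connected) (γ : G ≃g G) (o : V) (ω : BondConfig V) :
    (badHeavyClusters G o (BondConfig.relabel (sym2Equiv γ.toEquiv) ω)).encard =
      (badHeavyClusters G o ω).encard := by
  exact ENat.eq_of_forall_natCast_le_iff fun k =>
    le_encard_badHeavyClusters_relabel_iff G hconn γ o ω k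

/-! ### Measurability -/

section Measurable

variable [Countable V]

/-- `{C(x) is bad}` is measurable (`V` countable): a countable intersection over `S` and `y` of
`{x ↮ y} ∪ {y ↮ ∞ via the levels of S}`. [folklore] -/
theorem measurableSet_levelBad (G : SimpleGraph V) (x : V) :
    MeasurableSet {ω : BondConfig V | LevelBad G ω x} := by
  have h : {ω : BondConfig V | LevelBad G ω x} = ⋂ S : Finset V, ⋂ y : V,
      ({ω : BondConfig V | (openGraph ω).Reachable x y}ᶜ ∪
        (percolatesVia (withinGraph G (levelUnion G S)) y)ᶜ) := by
    ext ω
    simp only [Set.mem_iInter, Set.mem_setOf_eq, LevelBad]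
    refine forall_congr' fun S => forall_congr' fun y => ?_
    rw [Set.mem_union, Set.mem_compl_iff, Set.mem_compl_iff, Set.mem_setOf_eq, percolatesVia,
      Set.mem_setOf_eq, Set.not_infinite, imp_iff_not_or]
    rfl
  rw [h]
  exact MeasurableSet.iInter fun S => MeasurableSet.iInter fun y =>
    (measurableSet_setOf_reachable x y).compl.union (measurableSet_percolatesVia _ y).compl

/-- `{C(x) is heavy and bad}` is measurable. [folklore] -/
theorem measurableSet_isHeavy_and_levelBad (G : SimpleGraph V) (o x : V) :
    MeasurableSet {ω : BondConfig V | IsHeavy G o (openCluster ω x) ∧ LevelBad G ω x} :=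
  (measurableSet_isHeavy_openCluster G o x).inter (measurableSet_levelBad G x)

/-- `{at least k bad heavy clusters}` is measurable (`V` countable). [folklore] -/
theorem measurableSet_le_encard_badHeavyClusters (G : SimpleGraph V) (o : V) (k : ℕ) :
    MeasurableSet {ω : BondConfig V | (k : ℕ∞) ≤ (badHeavyClusters G o ω).encard} := by
  have h : {ω : BondConfig V | (k : ℕ∞) ≤ (badHeavyClusters G o ω).encard} =
      ⋃ s : Finset V, ⋃ (_ : s.card = k),
        ((⋂ x ∈ s, {ω : BondConfig V | IsHeavy G o (openCluster ω x) ∧ LevelBad G ω x}) ∩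
          ⋂ x ∈ s, ⋂ y ∈ s, {ω : BondConfig V | x ≠ y → ¬ (openGraph ω).Reachable x y}) := by
    ext ω
    simp only [Set.mem_setOf_eq, le_encard_badHeavyClusters_iff, Set.mem_iUnion,
      Set.mem_inter_iff, Set.mem_iInter, exists_prop, Set.Pairwise, Finset.mem_coe]
  rw [h]
  refine MeasurableSet.iUnion fun s => MeasurableSet.iUnion fun _ => ?_
  refine (s.measurableSet_biInter fun x _ => measurableSet_isHeavy_and_levelBad G o x).inter
    (s.measurableSet_biInter fun x _ => s.measurableSet_biInter fun y _ => ?_)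
  by_cases hxy : x = y
  · have : {ω : BondConfig V | x ≠ y → ¬ (openGraph ω).Reachable x y} = Set.univ :=
      Set.eq_univ_of_forall fun ω h => absurd hxy h
    rw [this]; exact MeasurableSet.univ
  · have : {ω : BondConfig V | x ≠ y → ¬ (openGraph ω).Reachable x y} =
        {ω : BondConfig V | (openGraph ω).Reachable x y}ᶜ := by
      ext ω; simp [hxy]
    rw [this]; exact (measurableSet_setOf_reachable x y).compl

/-- `{exactly k bad heavy clusters}` is measurable. [folklore] -/
theorem measurableSet_encard_badHeavyClusters_eq (G : SimpleGraph V) (o : V) (k : ℕ) :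
    MeasurableSet {ω : BondConfig V | (badHeavyClusters G o ω).encard = k} := by
  have h : {ω : BondConfig V | (badHeavyClusters G o ω).encard = k} =
      {ω | (k : ℕ∞) ≤ (badHeavyClusters G o ω).encard} \
        {ω | ((k + 1 : ℕ) : ℕ∞) ≤ (badHeavyClusters G o ω).encard} := by
    ext ω
    simp only [Set.mem_setOf_eq, Set.mem_sdiff, Nat.cast_add, Nat.cast_one]
    constructor
    · intro h
      refine ⟨h.symm.le, fun h' => ?_⟩
      rw [h] at h'
      exact absurd h' (by norm_cast; omega)
    · rintro ⟨h1, h2⟩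
      rw [not_le, ENat.lt_add_one_iff (ENat.coe_ne_top k)] at h2
      exact le_antisymm h2 h1
  rw [h]
  exact (measurableSet_le_encard_badHeavyClusters G o k).diff
    (measurableSet_le_encard_badHeavyClusters G o (k + 1))

/-- **`{infinitely many bad heavy clusters}` is measurable** (`V` countable). [folklore] -/
theorem measurableSet_infinite_badHeavyClusters (G : SimpleGraph V) (o : V) :
    MeasurableSet {ω : BondConfig V | (badHeavyClusters G o ω).Infinite} := by
  have h : {ω : BondConfig V | (badHeavyClusters G o ω).Infinite} =
      ⋂ k : ℕ, {ω : BondConfig V | (k : ℕ∞) ≤ (badHeavyClusters G o ω).encard} := by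
    ext ω
    simp only [Set.mem_setOf_eq, Set.mem_iInter, infinite_badHeavyClusters_iff]
  rw [h]
  exact MeasurableSet.iInter fun k => measurableSet_le_encard_badHeavyClusters G o k

/-- `{no bad heavy cluster}` is measurable. [folklore] -/
theorem measurableSet_badHeavyClusters_eq_empty (G : SimpleGraph V) (o : V) :
    MeasurableSet {ω : BondConfig V | badHeavyClusters G o ω = ∅} := by
  have h : {ω : BondConfig V | badHeavyClusters G o ω = ∅} =
      {ω | ((1 : ℕ) : ℕ∞) ≤ (badHeavyClusters G o ω).encard}ᶜ := by
    ext ω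
    simp only [Set.mem_setOf_eq, Set.mem_compl_iff, Nat.cast_one, Order.one_le_iff_ne_zero,
      ne_eq, Set.encard_eq_zero, not_not]
  rw [h]
  exact (measurableSet_le_encard_badHeavyClusters G o 1).compl

end Measurable

/-! ### Merging lowers the number of bad heavy clusters -/

/-- **A bad heavy cluster of `ω ∪ F` (`F` finite) contains a bad heavy cluster of `ω`**: the
`(ω ∪ F)`-cluster of `z` is covered by the `ω`-clusters of `z` and of the finitely many endpoints
of edges of `F` it contains (`reachable_or_exists_endpoint_of_walk_union`), so one of these
`ω`-clusters is heavy (`IsHeavy.exists_isHeavy_inter`); it is bad because badness passes to the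
`ω`-clusters inside a bad `(ω ∪ F)`-cluster (`LevelBad.anti_of_mem`).
[cite: Timar2006, Lemma 5.3 (proof: insertion tolerance)] [cite: LyonsPeres2016, Thm. 7.5 (proof)] -/
theorem exists_isHeavy_levelBad_of_union_finset {G : SimpleGraph V} [G.LocallyFinite]
    (hconn : G.Connected) {o : V} {ω : BondConfig V} {F : Finset (Sym2 V)} {z : V}
    (hz : IsHeavy G o (openCluster (ω ∪ ↑F) z)) (hbad : LevelBad G (ω ∪ ↑F) z) :
    ∃ u, (openGraph (ω ∪ ↑F)).Reachable z u ∧ IsHeavy G o (openCluster ω u) ∧ LevelBad G ω u := by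
  set ω' : BondConfig V := ω ∪ ↑F with hω'
  set U : Set V := {z} ∪ {u | (∃ e ∈ F, u ∈ e) ∧ (openGraph ω').Reachable u z} with hU
  have hUfin : U.Finite := by
    refine (Set.finite_singleton z).union ?_
    refine Set.Finite.subset (F.finite_toSet.biUnion fun e _ => Sym2.finite_setOf_mem e) ?_
    rintro u ⟨⟨e, he, hue⟩, -⟩
    exact Set.mem_biUnion he hue
  have hUz : ∀ u ∈ U, (openGraph ω').Reachable z u := by
    rintro u (hu | ⟨-, hu⟩)
    · rw [Set.mem_singleton_iff] at hu; rw [hu]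
    · exact hu.symm
  have hcov : openCluster ω' z ⊆ ∅ ∪ ⋃ u ∈ hUfin.toFinset, openCluster ω u := by
    intro v hv
    refine Or.inr ?_
    obtain ⟨q⟩ := (hv : (openGraph ω').Reachable z v).symm
    rcases reachable_or_exists_endpoint_of_walk_union q with h | ⟨a, ha, haz, hav⟩
    · exact Set.mem_iUnion₂.2 ⟨z, hUfin.mem_toFinset.2 (Or.inl rfl), h⟩
    · exact Set.mem_iUnion₂.2 ⟨a, hUfin.mem_toFinset.2 (Or.inr ⟨ha, haz⟩), hav⟩
  obtain ⟨u, hu, hheavy⟩ := IsHeavy.exists_isHeavy_inter hconn hz Set.finite_empty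
    hUfin.toFinset (fun u => openCluster ω u) hcov
  have huU : u ∈ U := hUfin.mem_toFinset.1 hu
  exact ⟨u, hUz u huU, hheavy.mono Set.inter_subset_right,
    hbad.anti_of_mem Set.subset_union_left (hUz u huU)⟩

/-- **Joining a bad heavy cluster to another heavy cluster by opening a walk lowers the number of
bad heavy clusters** (the "N takes a strictly smaller value" step of Lyons–Peres 2016, proof of
Thm. 7.5, for bad heavy clusters): if `ω` has exactly `k < ∞` bad heavy clusters, `C(x)` is bad and
heavy, `C(y)` is heavy and not joined to `x`, and `F` is the edge set of a walk of `G` from `x` to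
`y`, then `ω ∪ F` has fewer than `k` bad heavy clusters. Proof: `k` bad heavy clusters of `ω ∪ F`
contain `k` pairwise disconnected bad heavy clusters of `ω` (`exists_isHeavy_levelBad_of_union_finset`),
and one more is found among `C(x)`, `C(y)`: `C(x)` unless some of the `k` is joined to `x`, in which
case the merged cluster — which is then one of the `k`, hence bad — contains `C(y)`, so `C(y)` is
bad and is joined to none of the `k`. [cite: Timar2006, Lemma 5.3 (proof: insertion tolerance)]
[cite: LyonsPeres2016, Thm. 7.5 (proof)] -/
theorem union_not_le_encard_badHeavyClusters [DecidableEq V] {G : SimpleGraph V} [G.LocallyFinite]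
    (hconn : G.Connected) {o : V} {ω : BondConfig V} {x y : V} (w : G.Walk x y)
    (hx : IsHeavy G o (openCluster ω x)) (hxbad : LevelBad G ω x)
    (hy : IsHeavy G o (openCluster ω y)) (hxy : ¬ (openGraph ω).Reachable x y) {k : ℕ}
    (hk : (badHeavyClusters G o ω).encard = k) :
    ¬ ((k : ℕ∞) ≤ (badHeavyClusters G o (ω ∪ ↑(w.edges.toFinset))).encard) := by
  set F : Finset (Sym2 V) := w.edges.toFinset with hF
  set ω' : BondConfig V := ω ∪ ↑F with hω'
  have hmono : ∀ {a b : V}, (openGraph ω).Reachable a b → (openGraph ω').Reachable a b :=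
    fun h => h.mono (openGraph_mono Set.subset_union_left)
  have hxy' : (openGraph ω').Reachable x y :=
    reachable_openGraph_of_edges_mem w fun e he => Set.mem_union_right _ (by simp [hF, he])
  rw [le_encard_badHeavyClusters_iff]
  rintro ⟨s, hcard, hbad, hpair⟩
  -- bad heavy `ω`-clusters inside the `ω'`-clusters of the vertices of `s`
  have hrep : ∀ z : V, ∃ u, z ∈ s →
      (openGraph ω').Reachable z u ∧ IsHeavy G o (openCluster ω u) ∧ LevelBad G ω u := by
    intro z
    by_cases hz : z ∈ s
    · obtain ⟨u, hu⟩ := exists_isHeavy_levelBad_of_union_finset hconn (hbad z hz).1 (hbad z hz).2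
      exact ⟨u, fun _ => hu⟩
    · exact ⟨z, fun h => absurd h hz⟩
  choose u hu using hrep
  have hsep : ∀ z ∈ s, ∀ z' ∈ s, (openGraph ω').Reachable (u z) (u z') → z = z' := by
    intro z hz z' hz' hr
    by_contra hne
    exact hpair hz hz' hne (((hu z hz).1.trans hr).trans (hu z' hz').1.symm)
  have hinj : Set.InjOn u ↑s := fun z hz z' hz' h => hsep z hz z' hz' (by rw [h])
  -- a vertex `v₀ ∈ {x, y}` with bad heavy `ω`-cluster, joined in `ω` to none of the `u z`
  obtain ⟨v₀, hv₀, hv₀sep⟩ : ∃ v₀, (IsHeavy G o (openCluster ω v₀) ∧ LevelBad G ω v₀) ∧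
      ∀ z ∈ s, ¬ (openGraph ω).Reachable (u z) v₀ := by
    by_cases h : ∃ z ∈ s, (openGraph ω).Reachable (u z) x
    · obtain ⟨z, hz, hzx⟩ := h
      -- the `ω'`-cluster of `z` is bad and contains `y`, so `C_ω(y)` is bad
      have hzy : (openGraph ω').Reachable z y := ((hu z hz).1.trans (hmono hzx)).trans hxy'
      have hybad : LevelBad G ω y := (hbad z hz).2.anti_of_mem Set.subset_union_left hzy
      refine ⟨y, ⟨hy, hybad⟩, fun z' hz' hz'y => ?_⟩
      have hzz' : z = z' := hsep z hz z' hz' (((hmono hzx).trans hxy').trans (hmono hz'y).symm)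
      subst hzz'
      exact hxy (hzx.symm.trans hz'y)
    · push Not at h
      exact ⟨x, ⟨hx, hxbad⟩, h⟩
  -- the `k + 1` vertices `v₀, u z (z ∈ s)` witness `k + 1` bad heavy clusters of `ω`
  have hmem : ((k + 1 : ℕ) : ℕ∞) ≤ (badHeavyClusters G o ω).encard := by
    rw [le_encard_badHeavyClusters_iff]
    refine ⟨insert v₀ (s.image u), ?_, ?_, ?_⟩
    · rw [Finset.card_insert_of_notMem, Finset.card_image_of_injOn hinj, hcard]
      rw [Finset.mem_image]
      rintro ⟨z, hz, hzv⟩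
      exact hv₀sep z hz (by rw [hzv])
    · intro v hv
      rw [Finset.mem_insert, Finset.mem_image] at hv
      rcases hv with rfl | ⟨z, hz, rfl⟩
      · exact hv₀
      · exact (hu z hz).2
    · intro a ha b hb hab
      rw [Finset.coe_insert, Finset.coe_image, Set.mem_insert_iff, Set.mem_image] at ha hb
      rcases ha with rfl | ⟨z, hz, rfl⟩ <;> rcases hb with rfl | ⟨z', hz', rfl⟩
      · exact absurd rfl hab
      · exact fun h => hv₀sep z' hz' h.symm
      · exact fun h => hv₀sep z hz h
      · exact fun h => hab (by rw [hsep z hz z' hz' (hmono h)])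
  rw [hk] at hmem
  exact absurd hmem (by norm_cast; omega)

/-! ### Almost surely: no bad heavy cluster, or infinitely many -/

/-- A measurable event of probability one holds almost surely. [folklore] -/
theorem ae_mem_of_prob_eq_one {Ω : Type*} [MeasurableSpace Ω] {μ : Measure Ω}
    [IsProbabilityMeasure μ] {E : Set Ω} (hE : MeasurableSet E) (h1 : μ E = 1) :
    ∀ᵐ ω ∂μ, ω ∈ E := by
  have h0 : μ Eᶜ = 0 := (prob_compl_eq_zero_iff hE).2 h1
  filter_upwards [measure_eq_zero_iff_ae_notMem.1 h0] with ω hω using Set.notMem_compl_iff.1 hω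

/-- Under `P_0` there is no heavy cluster: "almost surely infinitely many heavy clusters" forces
`p > 0`. [folklore] -/
theorem pos_of_ae_infinite_heavyClusters [Countable V] (G : SimpleGraph V) [G.LocallyFinite]
    (hconn : G.Connected) (o : V) (p : unitInterval)
    (hheavy : ∀ᵐ ω ∂(bondPercolation G p), (heavyClusters G o ω).Infinite) : 0 < (p : ℝ) := by
  rcases p.2.1.eq_or_lt with h0 | h0
  · exfalso
    have hp0 : p = 0 := Subtype.ext h0.symm
    have hN : ∀ᵐ ω ∂(bondPercolation G p), numInfiniteClusters ω = 0 := by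
      rw [hp0]; exact ae_numInfiniteClusters_eq_zero_bot G
    have hF : ∀ᵐ ω ∂(bondPercolation G p), False := by
      filter_upwards [hheavy, hN] with ω hω hN0
      rw [numInfiniteClusters_eq_encard, Set.encard_eq_zero] at hN0
      have hsub := heavyClusters_subset_infiniteClusters G hconn o ω
      rw [hN0, Set.subset_empty_iff] at hsub
      rw [hsub] at hω
      exact hω Set.finite_empty
    rw [eventually_false_iff_eq_bot, ae_eq_bot] at hF
    exact IsProbabilityMeasure.ne_zero _ hF
  · exact h0

/-- Under `P_1` the configuration is `E(G)` and the connected graph `G` is a single cluster: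
"almost surely infinitely many heavy clusters" forces `p < 1`. [folklore] -/
theorem lt_one_of_ae_infinite_heavyClusters [Countable V] (G : SimpleGraph V) [G.LocallyFinite]
    (hconn : G.Connected) (o : V) (p : unitInterval)
    (hheavy : ∀ᵐ ω ∂(bondPercolation G p), (heavyClusters G o ω).Infinite) : (p : ℝ) < 1 := by
  by_contra hge
  have hp1 : p = 1 := Subtype.ext (le_antisymm p.2.2 (not_lt.1 hge))
  have hμ : bondPercolation G p = Measure.dirac G.edgeSet := by
    rw [hp1]
    simp only [bondPercolation, ProbabilityTheory.setBernoulli_one]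
  rw [hμ, ae_dirac_iff (measurableSet_infinite_heavyClusters G o)] at hheavy
  -- the open graph of `E(G)` is `G`, which is connected: one component only
  have hpre : (openGraph G.edgeSet).Preconnected := fun u v =>
    (hconn.preconnected u v).mono fun a b hab => (openGraph_adj _ a b).2 ⟨hab, hab.ne⟩
  haveI : Subsingleton (openGraph G.edgeSet).ConnectedComponent := hpre.subsingleton_connectedComponent
  exact hheavy (Set.toFinite _)

/-- **Timár 2006, towards Lemma 5.3 / Thm. 5.5 ("follows from insertion tolerance"), PROVED: almost
surely there is no bad heavy cluster or there are infinitely many.** On an infinite, connected,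
locally finite, quasi-transitive graph, under `P_p` with almost surely infinitely many heavy
clusters: each event `{#bad heavy clusters = k}` is `Aut(G)`-invariant
(`encard_badHeavyClusters_relabel`), hence trivial (`bondPercolation_zero_one_of_autInvariant`);
were it almost sure for some `1 ≤ k < ∞`, then with positive probability some bad heavy `C(x)` and
some other heavy `C(y)` meet, and opening the edges of a walk from `x` to `y` (insertion
tolerance, `bondPercolation_real_pos_of_openEdges`) would give fewer than `k` bad heavy clusters
with positive probability (`union_not_le_encard_badHeavyClusters`) — a contradiction.
[cite: Timar2006, Lemma 5.3 (proof: "The existence of encounter points follows from insertion tolerance") and Thm. 5.5 (proof: ω̄)]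
[cite: LyonsPeres2016, Prop. 7.3 and Thm. 7.5 (proof)] -/
theorem ae_badHeavyClusters_empty_or_infinite [Infinite V] (G : SimpleGraph V) [G.LocallyFinite]
    (hconn : G.Connected) (hqt : IsQuasiTransitive G) (o : V) (p : unitInterval)
    (hheavy : ∀ᵐ ω ∂(bondPercolation G p), (heavyClusters G o ω).Infinite) :
    ∀ᵐ ω ∂(bondPercolation G p),
      badHeavyClusters G o ω = ∅ ∨ (badHeavyClusters G o ω).Infinite := by
  classical
  haveI : Countable V := countable_of_connected_of_locallyFinite G hconn o
  set μ := bondPercolation G p with hμ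
  have hfar : ∀ U : Set V, U.Finite → ∃ γ : G ≃g G, Disjoint ((γ : V → V) '' U) U :=
    fun U hU => hqt.exists_iso_disjoint_image hconn U hU
  -- the invariant events `{#bad = k}` are trivial
  have hinvk : ∀ k : ℕ, μ {ω | (badHeavyClusters G o ω).encard = k} = 0 ∨
      μ {ω | (badHeavyClusters G o ω).encard = k} = 1 := fun k =>
    bondPercolation_zero_one_of_autInvariant G p hfar (measurableSet_encard_badHeavyClusters_eq G o k)
      fun γ => by
        ext ω
        simp only [Set.mem_preimage, Set.mem_setOf_eq]
        rw [encard_badHeavyClusters_relabel G hconn γ o ω]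
  -- it suffices that each `{#bad = k}`, `1 ≤ k < ∞`, is null
  suffices hnull : ∀ k : ℕ, 1 ≤ k → μ {ω | (badHeavyClusters G o ω).encard = k} = 0 by
    have hU : μ (⋃ k : ℕ, ⋃ (_ : 1 ≤ k), {ω | (badHeavyClusters G o ω).encard = k}) = 0 :=
      measure_iUnion_null fun k => measure_iUnion_null fun hk => hnull k hk
    filter_upwards [measure_eq_zero_iff_ae_notMem.1 hU] with ω hω
    by_contra hno
    rw [not_or] at hno
    obtain ⟨hne, hfin⟩ := hno
    have hfin' : (badHeavyClusters G o ω).Finite := Set.not_infinite.1 hfin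
    obtain ⟨k, hk⟩ : ∃ k : ℕ, (badHeavyClusters G o ω).encard = k :=
      ⟨_, hfin'.encard_eq_coe_toFinset_card⟩
    have hk1 : 1 ≤ k := by
      by_contra h0
      have hk0 : k = 0 := by omega
      subst hk0
      rw [Nat.cast_zero, Set.encard_eq_zero] at hk
      exact hne hk
    exact hω (Set.mem_iUnion₂.2 ⟨k, hk1, hk⟩)
  intro k hk1
  rcases hinvk k with h0 | h1
  · exact h0
  exfalso
  have hp : 0 < (p : ℝ) := pos_of_ae_infinite_heavyClusters G hconn o p hheavy
  have hAE : ∀ᵐ ω ∂μ, (badHeavyClusters G o ω).encard = k :=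
    ae_mem_of_prob_eq_one (measurableSet_encard_badHeavyClusters_eq G o k) h1
  -- with positive probability: `C(x)` bad heavy, `C(y)` heavy, not joined, `#bad = k`
  set A : V → V → Set (BondConfig V) := fun x y =>
    {ω | (IsHeavy G o (openCluster ω x) ∧ LevelBad G ω x) ∧ IsHeavy G o (openCluster ω y) ∧
      ¬ (openGraph ω).Reachable x y ∧ (badHeavyClusters G o ω).encard = k} with hAdef
  have hAunion : ∀ᵐ ω ∂μ, ω ∈ ⋃ x, ⋃ y, A x y := by
    filter_upwards [hAE, hheavy] with ω hω hH
    -- a bad heavy cluster `C(x)`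
    have h1 : ((1 : ℕ) : ℕ∞) ≤ (badHeavyClusters G o ω).encard := by
      rw [hω]; exact_mod_cast hk1
    obtain ⟨s, hcard, hbad, -⟩ := (le_encard_badHeavyClusters_iff G o ω 1).1 h1
    obtain ⟨x, rfl⟩ := Finset.card_eq_one.1 hcard
    have hxb := hbad x (Finset.mem_singleton_self x)
    -- two disjoint heavy clusters, one of which is not `C(x)`
    obtain ⟨t, htcard, hth, htpair⟩ :=
      (le_encard_heavyClusters_iff G o ω 2).1 ((infinite_heavyClusters_iff G o ω).1 hH 2)
    obtain ⟨a, b, hab, rfl⟩ := Finset.card_eq_two.1 htcard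
    have ha : a ∈ ({a, b} : Finset V) := by simp
    have hb : b ∈ ({a, b} : Finset V) := by simp
    by_cases hxa : (openGraph ω).Reachable x a
    · have hxb' : ¬ (openGraph ω).Reachable x b := fun h =>
        htpair (Finset.mem_coe.2 ha) (Finset.mem_coe.2 hb) hab (hxa.symm.trans h)
      exact Set.mem_iUnion.2 ⟨x, Set.mem_iUnion.2 ⟨b, hxb, hth b hb, hxb', hω⟩⟩
    · exact Set.mem_iUnion.2 ⟨x, Set.mem_iUnion.2 ⟨a, hxb, hth a ha, hxa, hω⟩⟩
  have hApos : ∃ x y, 0 < μ.real (A x y) := by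
    by_contra hno
    push Not at hno
    have h0 : ∀ x y, μ (A x y) = 0 := fun x y =>
      (measureReal_eq_zero_iff (measure_ne_top _ _)).1 (le_antisymm (hno x y) measureReal_nonneg)
    have hU : μ (⋃ x, ⋃ y, A x y) = 0 :=
      measure_iUnion_null fun x => measure_iUnion_null fun y => h0 x y
    have hF : ∀ᵐ ω ∂μ, False := by
      filter_upwards [hAunion, measure_eq_zero_iff_ae_notMem.1 hU] with ω h1 h2 using h2 h1
    rw [eventually_false_iff_eq_bot, ae_eq_bot] at hF
    exact IsProbabilityMeasure.ne_zero μ hF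
  obtain ⟨x, y, hxy⟩ := hApos
  -- insertion tolerance along a walk from `x` to `y`
  obtain ⟨w⟩ := hconn.preconnected x y
  set F : Finset (Sym2 V) := w.edges.toFinset with hF
  have hFE : (↑F : Set (Sym2 V)) ⊆ G.edgeSet := by
    intro e he
    simp only [hF, Finset.mem_coe, List.mem_toFinset] at he
    exact w.edges_subset_edgeSet he
  set E : Set (BondConfig V) := {ω | ¬ ((k : ℕ∞) ≤ (badHeavyClusters G o ω).encard)} with hE
  have hEm : MeasurableSet E := (measurableSet_le_encard_badHeavyClusters G o k).compl
  have hpos : 0 < μ.real E :=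
    bondPercolation_real_pos_of_openEdges G hp F hFE hEm hxy fun ω hω =>
      union_not_le_encard_badHeavyClusters hconn w hω.1.1 hω.1.2 hω.2.1 hω.2.2.1 hω.2.2.2
  have hzero : μ.real E = 0 := by
    rw [measureReal_eq_zero_iff (measure_ne_top _ _)]
    refine measure_mono_null ?_ (ae_iff.1 hAE)
    intro ω hω h
    exact hω (le_of_eq (Eq.symm h))
  linarith

/-- **If bad heavy clusters are not almost surely absent, there are almost surely infinitely
many** (ergodicity once more: `{infinitely many bad heavy clusters}` is invariant, and null would
mean, by `ae_badHeavyClusters_empty_or_infinite`, that almost surely there is none).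
[cite: Timar2006, Thm. 5.5 (proof: "Suppose that for some heavy cluster C … Note that ω̄ is invariant")]
[cite: LyonsPeres2016, Prop. 7.3] -/
theorem ae_infinite_badHeavyClusters_of_not_ae_empty [Infinite V] (G : SimpleGraph V)
    [G.LocallyFinite] (hconn : G.Connected) (hqt : IsQuasiTransitive G) (o : V) (p : unitInterval)
    (hheavy : ∀ᵐ ω ∂(bondPercolation G p), (heavyClusters G o ω).Infinite)
    (h : ¬ ∀ᵐ ω ∂(bondPercolation G p), badHeavyClusters G o ω = ∅) :
    ∀ᵐ ω ∂(bondPercolation G p), (badHeavyClusters G o ω).Infinite := by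
  haveI : Countable V := countable_of_connected_of_locallyFinite G hconn o
  have h01 := bondPercolation_zero_one_of_autInvariant G p
    (fun U hU => hqt.exists_iso_disjoint_image hconn U hU)
    (measurableSet_infinite_badHeavyClusters G o) fun γ => by
      ext ω
      simp only [Set.mem_preimage, Set.mem_setOf_eq]
      exact infinite_badHeavyClusters_relabel_iff G hconn γ o ω
  rcases h01 with h0 | h1
  · exfalso
    apply h
    filter_upwards [ae_badHeavyClusters_empty_or_infinite G hconn hqt o p hheavy,
      measure_eq_zero_iff_ae_notMem.1 h0] with ω hω hω'
    exact hω.resolve_right hω'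
  · exact ae_mem_of_prob_eq_one (measurableSet_infinite_badHeavyClusters G o) h1

/-- **Reduction of Thm. 5.5 to the refutation of "almost surely infinitely many bad heavy
clusters"** — the shape in which the printed proof proceeds ("Suppose that for some heavy cluster
`C` … Let `ω̄` be the subgraph consisting of these `C`'s … This will contradict Lemma 5.1"): to
prove `Timar2006_finiteLevelUnion` it suffices to derive a contradiction, on every infinite
(countable) connected, locally finite, transitive, nonunimodular graph and for every `0 < p < 1`
with almost surely infinitely many heavy clusters, from "almost surely there are infinitely many
bad heavy clusters" (finiteness of `V`, `p = 0` and `p = 1` being incompatible with the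
hypothesis, and "some bad heavy cluster with positive probability" having been upgraded by
`ae_infinite_badHeavyClusters_of_not_ae_empty`).
[cite: Timar2006, Thm. 5.5 (proof, first paragraph)] -/
theorem Timar2006_finiteLevelUnion_of_not_ae_infinite_bad
    (h : ∀ {V : Type} [Infinite V] [Countable V] (G : SimpleGraph V) [G.LocallyFinite],
      G.Connected → IsGraphTransitive G → ¬ IsGraphUnimodular G → ∀ (o : V) (p : unitInterval),
        0 < (p : ℝ) → (p : ℝ) < 1 →
        (∀ᵐ ω ∂(bondPercolation G p), (heavyClusters G o ω).Infinite) →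
          (∀ᵐ ω ∂(bondPercolation G p), (badHeavyClusters G o ω).Infinite) → False) :
    Timar2006_finiteLevelUnion := by
  intro V G _ hconn ht hU o p hheavy
  -- `V` is infinite (there are heavy clusters)
  rcases finite_or_infinite V with hfin | hinf
  · exfalso
    have hF : ∀ᵐ ω ∂(bondPercolation G p), False := by
      filter_upwards [hheavy] with ω hω
      apply hω
      have : heavyClusters G o ω = ∅ :=
        Set.eq_empty_of_forall_notMem fun C hC => (IsHeavy.infinite hconn hC) (Set.toFinite _)
      rw [this]
      exact Set.finite_empty
    rw [eventually_false_iff_eq_bot, ae_eq_bot] at hF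
    exact IsProbabilityMeasure.ne_zero _ hF
  haveI : Nonempty V := ⟨o⟩
  haveI : Countable V := countable_of_connected_of_locallyFinite G hconn o
  have hp0 : 0 < (p : ℝ) := pos_of_ae_infinite_heavyClusters G hconn o p hheavy
  have hp1 : (p : ℝ) < 1 := lt_one_of_ae_infinite_heavyClusters G hconn o p hheavy
  have hempty : ∀ᵐ ω ∂(bondPercolation G p), badHeavyClusters G o ω = ∅ := by
    by_contra hne
    exact h G hconn ht hU o p hp0 hp1 hheavy
      (ae_infinite_badHeavyClusters_of_not_ae_empty G hconn ht.isQuasiTransitive o p hheavy hne)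
  filter_upwards [hempty] with ω hω
  exact (badHeavyClusters_eq_empty_iff G o ω).1 hω

end Literature.Barriers.CriticalPhenomena

end
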